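import Literature.Probability.Moments.VarianceBookkeeping
import Literature.MathematicalPhysics.KineticTheory.EvenCollisionTubeFunctional
import Literature.MathematicalPhysics.KineticTheory.HardSphereEulerProofs
import Summits.AtomisticToContinuum.HydrodynamicLimit.Theorems.JParityClosureOddContactSymmetryGibbsInvariance
import Summits.AtomisticToContinuum.HydrodynamicLimit.Theorems.JParityClosureOddContactSymmetryTubeStatRegular
import HarnessLib

/-!
# S4 `stub_fixedTimeVariance` of the crux line `even-rung-mean-variance`
# (`JParityClosure.EvenStressEnskog`, stmt-AtomisticToContinuum-13079): the rung-0 reduction, the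
# split, and the reduction to two fixed-time concentration inputs (`stub_fixedTimeVarianceOfEvolved`)

S4 asks, uniformly in `t ∈ [0, τ]` and for `N ≥ N₀(r, L, κ, ς, …)`, `Var_{LG}(W_t ∘ Φ_t) ≤ ς` for
`W_t = evenTubeStat σ N χ g (evenMarkTrunc k l L) r κ t = A_t − σ³ e_t` (`A_t = tubeStat … r r 1 κ t`,
the collision-tube functional at truncation level `1`; `e_t = enskogRate … r t`, the Enskog rate
functional of the SAME configuration) under `LG = localGibbsLaw σ a₀ u₀ θ₀ N (Φ N)`.  For `t > 0`
this is propagation of microscopic decorrelation along the deterministic flow (open); at rung 0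
(constant profiles) it is a STATIC quantity of the canonical Gibbs law.  Proved here:
`variance_comp_flow_localGibbsLaw_const` (RUNG-0 REDUCTION `Var_G(f ∘ Φ_t) = Var_G(f)`, tree
`measurePreserving_flow_localGibbsLaw_const`); the tube half (`A_t`, `A_t ∘ Φ_t` measurable, in
`L²`, `Var ≤ B²` with the tree's uniform bound — not small, it fixes the frame; `W_t` measurable
once `e_t` is); the split `Var(W_t ∘ Φ_t) ≤ 2 Var(A_t ∘ Φ_t) + 2 (σ³)² Var(e_t ∘ Φ_t)`
(`variance_evenTubeStat_flow_le`, bookkeeping from `Literature.Probability.Moments.VarianceBookkeeping`);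
and the reductions with the missing inputs written as hypothesis TYPES in the crux's quantifier
frame: `fixedTimeVariance_of_evolved` (tube-half + Enskog-half fixed-time concentration under the
evolved law ⇒ S4 verbatim; registered helper stub `stub_fixedTimeVarianceOfEvolved`, arrow form),
`fixedTimeVariance_rung0_of_staticW` (rung 0 ⇔ the static variance of `W_t` itself) and
`fixedTimeVariance_rung0_of_static` (rung 0 from the static variances of `A_t` and `e_t`).

References: H. Spohn, *Large Scale Dynamics of Interacting Particles* (1991), Part I §2.3, Ch. 3;
E. Pulvirenti, D. Tsagkarogiannis, Comm. Math. Phys. 316 (2012) §3–4 (canonical cluster expansion).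
-/

noncomputable section

open MeasureTheory ProbabilityTheory Set
open scoped ENNReal

namespace Summit.AtomisticToContinuum.HydrodynamicLimit.Theorems.EvenStressEnskog

open Literature.Analysis.FluidPDE Literature.MathematicalPhysics.KineticTheory
open Literature.Probability.Moments

/-! ## Rung 0: the fixed-time variance is static -/

/-- **Rung-0 reduction of S4.**  For CONSTANT profiles `(a, u, θ)` the local Gibbs law
`G_N = localGibbsLaw σ a u θ N Φ` is invariant under every hard-sphere flow map
(`measurePreserving_flow_localGibbsLaw_const`), hence for every a.e.-measurable observable `f` and
every time `t`, `Var_{G_N}(f ∘ Φ_t) = Var_{G_N}(f)`: the fixed-time variance of S4 at rung 0 is a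
STATIC equilibrium quantity. [folklore] -/
theorem variance_comp_flow_localGibbsLaw_const (σ a θ : ℝ) (u : V3) (N : ℕ)
    (Φ : HardSphereFlow (Torus.geometry (Fin 3)) (hsDiameter σ N) (N + 1)) (t : ℝ)
    {f : Config (N + 1) (Fin 3) T3 → ℝ}
    (hf : AEMeasurable f (localGibbsLaw σ (fun _ => a) (fun _ => u) (fun _ => θ) N Φ)) :
    ProbabilityTheory.variance (fun z => f (Φ.flow t z))
        (localGibbsLaw σ (fun _ => a) (fun _ => u) (fun _ => θ) N Φ) =
      ProbabilityTheory.variance f (localGibbsLaw σ (fun _ => a) (fun _ => u) (fun _ => θ) N Φ) :=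
  (measurePreserving_flow_localGibbsLaw_const σ a θ u N Φ t).variance_fun_comp hf

/-! ## The tube half: measurability, `L²`, the (non-small) sup-bound variance estimate -/

/-- The tube functional at a fixed time label is Borel measurable in the configuration
(section of the tree's joint measurability `measurable_tubeStat_uncurry`). [folklore] -/
theorem measurable_tubeStat_at (σ : ℝ) (N : ℕ) {χ : ℝ × UnitAddTorus (Fin 3) → ℝ} {g : ℝ → ℝ}
    {Ψ : V3 × V3 × V3 → ℝ} (hχ : Continuous χ) (hg : Continuous g) (hΨ : Continuous Ψ)
    (r ϑ L κ t : ℝ) : Measurable fun z => tubeStat σ N χ g Ψ r ϑ L κ t z :=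
  (measurable_tubeStat_uncurry σ N hχ hg hΨ r ϑ L κ).of_uncurry_left

/-- The transported tube functional `A_t ∘ Φ_t` is Borel measurable. [folklore] -/
theorem measurable_tubeStat_flow (σ : ℝ) (N : ℕ) {χ : ℝ × UnitAddTorus (Fin 3) → ℝ} {g : ℝ → ℝ}
    {Ψ : V3 × V3 × V3 → ℝ} (hχ : Continuous χ) (hg : Continuous g) (hΨ : Continuous Ψ)
    (r ϑ L κ t : ℝ) (Φ : HardSphereFlow (Torus.geometry (Fin 3)) (hsDiameter σ N) (N + 1)) :
    Measurable fun z => tubeStat σ N χ g Ψ r ϑ L κ t (Φ.flow t z) :=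
  (measurable_tubeStat_at σ N hχ hg hΨ r ϑ L κ t).fun_comp (Φ.measurable_flow t)

/-- The even tube functional `W_t = A_t − σ³ e_t` at a fixed time label is Borel measurable as
soon as the Enskog rate functional `e_t` is (the tube part is, by the tree). [folklore] -/
theorem measurable_evenTubeStat_of (σ : ℝ) (N : ℕ) {χ : ℝ × UnitAddTorus (Fin 3) → ℝ}
    {g : ℝ → ℝ} {Ξ : V3 × V3 × V3 → ℝ} (hχ : Continuous χ) (hg : Continuous g)
    (hΞ : Continuous Ξ) (r κ t : ℝ) (he : Measurable fun z => enskogRate σ N χ g Ξ r t z) :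
    Measurable fun z => evenTubeStat σ N χ g Ξ r κ t z := by
  simp only [evenTubeStat_def]
  exact (measurable_tubeStat_at σ N hχ hg hΞ r r 1 κ t).sub (he.const_mul _)

/-- **Uniform bound of the even tube part** `A_t = tubeStat σ N χ g (Ξ_L^{kl}) r r 1 κ t` on
`[0, τ] × Config` (tree `exists_bound_tubeStat` with the bound `2L` of the truncated mark).
[folklore] -/
theorem exists_bound_tubeStat_even (σ : ℝ) (N : ℕ) {χ : ℝ × UnitAddTorus (Fin 3) → ℝ}
    {g : ℝ → ℝ} (hχ : Continuous χ) (hg : Continuous g) (k l : Fin 3) {L r κ : ℝ}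
    (hL : 0 ≤ L) (hr : 0 < r) (hκ : 0 ≤ κ) (τ : ℝ) :
    ∃ B : ℝ, ∀ t ∈ Set.Icc (0 : ℝ) τ, ∀ z : Config (N + 1) (Fin 3) T3,
      |tubeStat σ N χ g (evenMarkTrunc k l L) r r 1 κ t z| ≤ B :=
  exists_bound_tubeStat σ N hχ hg (exists_abs_evenMarkTrunc_le k l hL) hr r zero_le_one hκ τ

/-- The transported tube functional `A_t ∘ Φ_t` is in `L²` of any finite law, given a pointwise
bound `|A_t| ≤ B`. [folklore] -/
theorem memLp_tubeStat_flow (σ : ℝ) (N : ℕ) {χ : ℝ × UnitAddTorus (Fin 3) → ℝ} {g : ℝ → ℝ}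
    {Ψ : V3 × V3 × V3 → ℝ} (hχ : Continuous χ) (hg : Continuous g) (hΨ : Continuous Ψ)
    (r ϑ L κ t : ℝ) (Φ : HardSphereFlow (Torus.geometry (Fin 3)) (hsDiameter σ N) (N + 1))
    (P : Measure (Config (N + 1) (Fin 3) T3)) [IsFiniteMeasure P] {B : ℝ}
    (hB : ∀ z, |tubeStat σ N χ g Ψ r ϑ L κ t z| ≤ B) :
    MemLp (fun z => tubeStat σ N χ g Ψ r ϑ L κ t (Φ.flow t z)) 2 P :=
  memLp_two_of_abs_le (Filter.Eventually.of_forall fun z => hB (Φ.flow t z))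
    (measurable_tubeStat_flow σ N hχ hg hΨ r ϑ L κ t Φ).aestronglyMeasurable

/-- **Sup-bound variance estimate for the tube part** (NOT small; it fixes the frame):
`Var_P(A_t ∘ Φ_t) ≤ B²` for any probability law `P` and any pointwise bound `|A_t| ≤ B`.
[folklore] -/
theorem variance_tubeStat_flow_le_sq (σ : ℝ) (N : ℕ) {χ : ℝ × UnitAddTorus (Fin 3) → ℝ}
    {g : ℝ → ℝ} {Ψ : V3 × V3 × V3 → ℝ} (hχ : Continuous χ) (hg : Continuous g)
    (hΨ : Continuous Ψ) (r ϑ L κ t : ℝ)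
    (Φ : HardSphereFlow (Torus.geometry (Fin 3)) (hsDiameter σ N) (N + 1))
    (P : Measure (Config (N + 1) (Fin 3) T3)) [IsProbabilityMeasure P] {B : ℝ}
    (hB : ∀ z, |tubeStat σ N χ g Ψ r ϑ L κ t z| ≤ B) :
    ProbabilityTheory.variance (fun z => tubeStat σ N χ g Ψ r ϑ L κ t (Φ.flow t z)) P ≤ B ^ 2 :=
  variance_le_sq_of_abs_le (Filter.Eventually.of_forall fun z => hB (Φ.flow t z))
    (measurable_tubeStat_flow σ N hχ hg hΨ r ϑ L κ t Φ).aemeasurable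

/-! ## The split `Var W ≤ 2 Var A + 2 σ⁶ Var e` -/

/-- **Splitting the even tube variance.**  For any finite law `P`, any flow map and any time
label: if `|A_t| ≤ B` pointwise and the Enskog rate functional `e_t` is Borel measurable, then
`Var_P(W_t ∘ Φ_t) ≤ 2 Var_P(A_t ∘ Φ_t) + 2 (σ³)² Var_P(e_t ∘ Φ_t)` (`W_t = A_t − σ³ e_t`,
`evenTubeStat_def`). [folklore] -/
theorem variance_evenTubeStat_flow_le (σ : ℝ) (N : ℕ) {χ : ℝ × UnitAddTorus (Fin 3) → ℝ}
    {g : ℝ → ℝ} {Ξ : V3 × V3 × V3 → ℝ} (hχ : Continuous χ) (hg : Continuous g)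
    (hΞ : Continuous Ξ) (r κ t : ℝ)
    (Φ : HardSphereFlow (Torus.geometry (Fin 3)) (hsDiameter σ N) (N + 1))
    (P : Measure (Config (N + 1) (Fin 3) T3)) [IsFiniteMeasure P] {B : ℝ}
    (hB : ∀ z, |tubeStat σ N χ g Ξ r r 1 κ t z| ≤ B)
    (he : Measurable fun z => enskogRate σ N χ g Ξ r t z) :
    ProbabilityTheory.variance (fun z => evenTubeStat σ N χ g Ξ r κ t (Φ.flow t z)) P ≤
      2 * ProbabilityTheory.variance (fun z => tubeStat σ N χ g Ξ r r 1 κ t (Φ.flow t z)) P +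
        2 * (σ ^ 3) ^ 2 *
          ProbabilityTheory.variance (fun z => enskogRate σ N χ g Ξ r t (Φ.flow t z)) P := by
  simp only [evenTubeStat_def]
  exact variance_sub_const_mul_le (memLp_tubeStat_flow σ N hχ hg hΞ r r 1 κ t Φ P hB)
    (he.fun_comp (Φ.measurable_flow t)).aestronglyMeasurable (σ ^ 3)

/-! ## The missing inputs (hypothesis types, in the crux's quantifier frame) and the reductions -/

/-- `(σ³)² ≤ 1` for `0 ≤ σ ≤ 1`. [folklore] -/
theorem cube_sq_le_one {σ : ℝ} (h0 : 0 ≤ σ) (h1 : σ ≤ 1) : (σ ^ 3) ^ 2 ≤ 1 := by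
  rw [← pow_mul]
  exact pow_le_one₀ h0 h1

/-- The final arithmetic of the split: `Var W ≤ 2 Var A + 2 s Var e`, `Var A ≤ ς/4`, `Var e ≤ ς/4`,
`0 ≤ Var e`, `s ≤ 1` give `Var W ≤ ς`. [folklore] -/
theorem split_le_of_le {vW vA vE s ς : ℝ} (hW : vW ≤ 2 * vA + 2 * s * vE) (hA : vA ≤ ς / 4)
    (hE : vE ≤ ς / 4) (hE0 : 0 ≤ vE) (hs1 : s ≤ 1) : vW ≤ ς := by
  nlinarith [mul_le_mul hs1 hE hE0 zero_le_one]

/-- **Reduction of S4 to two dynamical inputs** (the conclusion is the registered signature of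
`stub_fixedTimeVariance`, verbatim; arrow form = `stub_fixedTimeVarianceOfEvolved`).  Inputs, as
hypothesis types in the crux's frame `∃η₀ ∀profiles ∃σ₀ ∀σ ∀Φ ∀τ ∀χ ∀g ∀ς ∃r₀ ∀r ∀L κ ∃N₀ ∀N ∀k l ∀t`:
* `hA` — TUBE HALF: `Var_{LG}(A_t^{klL} ∘ Φ_t) ≤ ς`, `A_t^{klL} = tubeStat σ N χ g (evenMarkTrunc k l L)
  r r 1 κ t`, under the EVOLVED law `μ_t = (Φ_t)_# LG` — the sibling crux's registered S4 (13078,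
  there for every bounded continuous mark) at `Ψ = Ξ_L^{kl}`, level `1`, `ϑ = r`, except that `r₀`
  may not depend on the mark (`L, k, l` come after `r₀`; in truth `r₀` is idle).  Scales:
  `~κσ³(N+1)` ordered pairs in the tube, each weighted `≤ C_χ C_g 2L/((N+1)κ)`; diagonal and
  one-shared-particle covariances `O(L²σ⁶/(κ(N+1)))`, the `g(σ³ρ_r)` fluctuation
  `O(σ⁶/((N+1)r³))`, and the disjoint-pair covariance must be `o((κ/(N+1))²)` — propagation of
  microscopic spatial decorrelation along the deterministic flow, OPEN for `t > 0`;
* `hE` — ENSKOG HALF: `e_t = enskogRate σ N χ g (evenMarkTrunc k l L) r t` is Borel measurable and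
  `Var_{LG}(e_t ∘ Φ_t) ≤ ς`; `e_t = ∫_{𝕋³} χ(t,x) (g·Y)(σ³ρ_r(z,x)) B_r(z,x) dx` is a
  MACROSCOPIC-scale functional of the one- and two-particle empirical fields, so this is a
  fixed-time law of large numbers for the `r`-mollified fields under `μ_t` (open for `t > 0`).
The pair is SUFFICIENT but lossy (S4 only needs concentration of the DIFFERENCE `A_t − σ³ e_t`).
Assembly: `η₀ := min`, `σ₀ := min σ₁ σ₂ (1/2)` (probability law, `σ⁶ ≤ 1`), inputs at `ς/4`,
`r₀ := min`, `N₀ := max`, and `variance_evenTubeStat_flow_le`. [folklore] -/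
theorem fixedTimeVariance_of_evolved
    (hA : ∃ η₀ : ℝ, 0 < η₀ ∧ ∀ (a₀ θ₀ : T3 → ℝ) (u₀ : T3 → V3), Continuous a₀ → Continuous θ₀ →
      Continuous u₀ → (∀ x, 0 < a₀ x) → (∀ x, 0 < θ₀ x) → ∃ σ₀ : ℝ, 0 < σ₀ ∧ ∀ σ : ℝ, 0 < σ → σ < σ₀ →
      ∀ Φ : (N : ℕ) → HardSphereFlow (Torus.geometry (Fin 3)) (hsDiameter σ N) (N + 1),
      ∀ τ : ℝ, 0 < τ → ∀ χ : ℝ × UnitAddTorus (Fin 3) → ℝ, Continuous χ → ∀ g : ℝ → ℝ, Continuous g →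
      (∀ a, η₀ ≤ a → g a = 0) →
      ∀ ς : ℝ, 0 < ς → ∃ r₀ : ℝ, 0 < r₀ ∧ ∀ r : ℝ, 0 < r → r < r₀ →
      ∀ L κ : ℝ, 1 ≤ L → 0 < κ → κ ≤ 1 → ∃ N₀ : ℕ, ∀ N : ℕ, N₀ ≤ N → ∀ k l : Fin 3,
      ∀ t ∈ Set.Icc (0 : ℝ) τ,
        ProbabilityTheory.variance
          (fun z => tubeStat σ N χ g (evenMarkTrunc k l L) r r 1 κ t ((Φ N).flow t z))
          (localGibbsLaw σ a₀ u₀ θ₀ N (Φ N)) ≤ ς)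
    (hE : ∃ η₀ : ℝ, 0 < η₀ ∧ ∀ (a₀ θ₀ : T3 → ℝ) (u₀ : T3 → V3), Continuous a₀ → Continuous θ₀ →
      Continuous u₀ → (∀ x, 0 < a₀ x) → (∀ x, 0 < θ₀ x) → ∃ σ₀ : ℝ, 0 < σ₀ ∧ ∀ σ : ℝ, 0 < σ → σ < σ₀ →
      ∀ Φ : (N : ℕ) → HardSphereFlow (Torus.geometry (Fin 3)) (hsDiameter σ N) (N + 1),
      ∀ τ : ℝ, 0 < τ → ∀ χ : ℝ × UnitAddTorus (Fin 3) → ℝ, Continuous χ → ∀ g : ℝ → ℝ, Continuous g →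
      (∀ a, η₀ ≤ a → g a = 0) →
      ∀ ς : ℝ, 0 < ς → ∃ r₀ : ℝ, 0 < r₀ ∧ ∀ r : ℝ, 0 < r → r < r₀ →
      ∀ L κ : ℝ, 1 ≤ L → 0 < κ → κ ≤ 1 → ∃ N₀ : ℕ, ∀ N : ℕ, N₀ ≤ N → ∀ k l : Fin 3,
      ∀ t ∈ Set.Icc (0 : ℝ) τ,
        (Measurable fun z => enskogRate σ N χ g (evenMarkTrunc k l L) r t z) ∧
        ProbabilityTheory.variance
          (fun z => enskogRate σ N χ g (evenMarkTrunc k l L) r t ((Φ N).flow t z))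
          (localGibbsLaw σ a₀ u₀ θ₀ N (Φ N)) ≤ ς) :
    ∃ η₀ : ℝ, 0 < η₀ ∧ ∀ (a₀ θ₀ : T3 → ℝ) (u₀ : T3 → V3), Continuous a₀ → Continuous θ₀ → Continuous u₀ →
      (∀ x, 0 < a₀ x) → (∀ x, 0 < θ₀ x) → ∃ σ₀ : ℝ, 0 < σ₀ ∧ ∀ σ : ℝ, 0 < σ → σ < σ₀ →
      ∀ Φ : (N : ℕ) → HardSphereFlow (Torus.geometry (Fin 3)) (hsDiameter σ N) (N + 1),
      ∀ τ : ℝ, 0 < τ → ∀ χ : ℝ × UnitAddTorus (Fin 3) → ℝ, Continuous χ → ∀ g : ℝ → ℝ, Continuous g →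
      (∀ a, η₀ ≤ a → g a = 0) →
      ∀ ς : ℝ, 0 < ς → ∃ r₀ : ℝ, 0 < r₀ ∧ ∀ r : ℝ, 0 < r → r < r₀ →
      ∀ L κ : ℝ, 1 ≤ L → 0 < κ → κ ≤ 1 → ∃ N₀ : ℕ, ∀ N : ℕ, N₀ ≤ N → ∀ k l : Fin 3, ∀ t ∈ Set.Icc (0 : ℝ) τ,
        ProbabilityTheory.variance
          (fun z => evenTubeStat σ N χ g (evenMarkTrunc k l L) r κ t ((Φ N).flow t z))
          (localGibbsLaw σ a₀ u₀ θ₀ N (Φ N)) ≤ ς := by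
  obtain ⟨η₁, hη₁, HA⟩ := hA
  obtain ⟨η₂, hη₂, HE⟩ := hE
  refine ⟨min η₁ η₂, lt_min hη₁ hη₂, ?_⟩
  intro a₀ θ₀ u₀ ha hθ hu ha0 hθ0
  obtain ⟨σ₁, hσ₁, HA⟩ := HA a₀ θ₀ u₀ ha hθ hu ha0 hθ0
  obtain ⟨σ₂, hσ₂, HE⟩ := HE a₀ θ₀ u₀ ha hθ hu ha0 hθ0
  refine ⟨min (min σ₁ σ₂) (1 / 2), lt_min (lt_min hσ₁ hσ₂) (by norm_num), ?_⟩
  intro σ hσ hσlt Φ τ hτ χ hχ g hg hg0 ς hς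
  have hσ12 : σ < min σ₁ σ₂ := lt_of_lt_of_le hσlt (min_le_left _ _)
  have hσhalf : σ ≤ 1 / 2 := (lt_of_lt_of_le hσlt (min_le_right _ _)).le
  have hg1 : ∀ a, η₁ ≤ a → g a = 0 := fun a h => hg0 a ((min_le_left _ _).trans h)
  have hg2 : ∀ a, η₂ ≤ a → g a = 0 := fun a h => hg0 a ((min_le_right _ _).trans h)
  obtain ⟨r₁, hr₁, HA⟩ := HA σ hσ (lt_of_lt_of_le hσ12 (min_le_left _ _)) Φ τ hτ χ hχ g hg hg1
    (ς / 4) (by positivity)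
  obtain ⟨r₂, hr₂, HE⟩ := HE σ hσ (lt_of_lt_of_le hσ12 (min_le_right _ _)) Φ τ hτ χ hχ g hg hg2
    (ς / 4) (by positivity)
  refine ⟨min r₁ r₂, lt_min hr₁ hr₂, ?_⟩
  intro r hr hrlt L κ hL hκ hκ1
  obtain ⟨N₁, HA⟩ := HA r hr (lt_of_lt_of_le hrlt (min_le_left _ _)) L κ hL hκ hκ1
  obtain ⟨N₂, HE⟩ := HE r hr (lt_of_lt_of_le hrlt (min_le_right _ _)) L κ hL hκ hκ1
  refine ⟨max N₁ N₂, fun N hN k l t ht => ?_⟩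
  have hA' := HA N ((le_max_left _ _).trans hN) k l t ht
  obtain ⟨hem, hE'⟩ := HE N ((le_max_right _ _).trans hN) k l t ht
  haveI := isProbabilityMeasure_localGibbsLaw ha hθ hu ha0 hθ0 hσhalf N (Φ N)
  obtain ⟨B, hB⟩ := exists_bound_tubeStat_even σ N hχ hg k l (zero_le_one.trans hL) hr hκ.le τ
  have hsplit := variance_evenTubeStat_flow_le σ N hχ hg (continuous_evenMarkTrunc k l L) r κ t
    (Φ N) (localGibbsLaw σ a₀ u₀ θ₀ N (Φ N)) (fun z => hB t ht z) hem
  exact split_le_of_le hsplit hA' hE' (variance_nonneg _ _) (cube_sq_le_one hσ.le (by linarith))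

/-- **S4 at RUNG 0 is EXACTLY a static variance bound** (the sharpest rung-0 input).  For
constant profiles `(a, u, θ)`: if `e_t` is Borel measurable and the STATIC canonical variance of the
even tube functional satisfies `Var_{G_N}(W_t^{klL}) ≤ ς` for `N ≥ N₀` (hypothesis type `hW`, crux
frame — conditional concentration of the tube statistic on the Enskog functional of the SAME
configuration, no deterministic fields presupposed), then the registered signature holds at
constant profiles, by Gibbs invariance `Var_{G_N}(W_t ∘ Φ_t) = Var_{G_N}(W_t)`. [folklore] -/
theorem fixedTimeVariance_rung0_of_staticW
    (hW : ∃ η₀ : ℝ, 0 < η₀ ∧ ∀ (a θ : ℝ) (u : V3), 0 < a → 0 < θ → ∃ σ₀ : ℝ, 0 < σ₀ ∧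
      ∀ σ : ℝ, 0 < σ → σ < σ₀ →
      ∀ Φ : (N : ℕ) → HardSphereFlow (Torus.geometry (Fin 3)) (hsDiameter σ N) (N + 1),
      ∀ τ : ℝ, 0 < τ → ∀ χ : ℝ × UnitAddTorus (Fin 3) → ℝ, Continuous χ → ∀ g : ℝ → ℝ, Continuous g →
      (∀ a', η₀ ≤ a' → g a' = 0) →
      ∀ ς : ℝ, 0 < ς → ∃ r₀ : ℝ, 0 < r₀ ∧ ∀ r : ℝ, 0 < r → r < r₀ →
      ∀ L κ : ℝ, 1 ≤ L → 0 < κ → κ ≤ 1 → ∃ N₀ : ℕ, ∀ N : ℕ, N₀ ≤ N → ∀ k l : Fin 3,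
      ∀ t ∈ Set.Icc (0 : ℝ) τ,
        (Measurable fun z => enskogRate σ N χ g (evenMarkTrunc k l L) r t z) ∧
        ProbabilityTheory.variance (fun z => evenTubeStat σ N χ g (evenMarkTrunc k l L) r κ t z)
          (localGibbsLaw σ (fun _ => a) (fun _ => u) (fun _ => θ) N (Φ N)) ≤ ς) :
    ∃ η₀ : ℝ, 0 < η₀ ∧ ∀ (a θ : ℝ) (u : V3), 0 < a → 0 < θ → ∃ σ₀ : ℝ, 0 < σ₀ ∧ ∀ σ : ℝ, 0 < σ → σ < σ₀ →
      ∀ Φ : (N : ℕ) → HardSphereFlow (Torus.geometry (Fin 3)) (hsDiameter σ N) (N + 1),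
      ∀ τ : ℝ, 0 < τ → ∀ χ : ℝ × UnitAddTorus (Fin 3) → ℝ, Continuous χ → ∀ g : ℝ → ℝ, Continuous g →
      (∀ a', η₀ ≤ a' → g a' = 0) →
      ∀ ς : ℝ, 0 < ς → ∃ r₀ : ℝ, 0 < r₀ ∧ ∀ r : ℝ, 0 < r → r < r₀ →
      ∀ L κ : ℝ, 1 ≤ L → 0 < κ → κ ≤ 1 → ∃ N₀ : ℕ, ∀ N : ℕ, N₀ ≤ N → ∀ k l : Fin 3, ∀ t ∈ Set.Icc (0 : ℝ) τ,
        ProbabilityTheory.variance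
          (fun z => evenTubeStat σ N χ g (evenMarkTrunc k l L) r κ t ((Φ N).flow t z))
          (localGibbsLaw σ (fun _ => a) (fun _ => u) (fun _ => θ) N (Φ N)) ≤ ς := by
  obtain ⟨η₀, hη₀, H⟩ := hW
  refine ⟨η₀, hη₀, fun a θ u ha hθ => ?_⟩
  obtain ⟨σ₀, hσ₀, H⟩ := H a θ u ha hθ
  refine ⟨σ₀, hσ₀, fun σ hσ hσlt Φ τ hτ χ hχ g hg hg0 ς hς => ?_⟩
  obtain ⟨r₀, hr₀, H⟩ := H σ hσ hσlt Φ τ hτ χ hχ g hg hg0 ς hς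
  refine ⟨r₀, hr₀, fun r hr hrlt L κ hL hκ hκ1 => ?_⟩
  obtain ⟨N₀, H⟩ := H r hr hrlt L κ hL hκ hκ1
  refine ⟨N₀, fun N hN k l t ht => ?_⟩
  obtain ⟨hem, hW'⟩ := H N hN k l t ht
  rwa [variance_comp_flow_localGibbsLaw_const σ a θ u N (Φ N) t
    (measurable_evenTubeStat_of σ N hχ hg (continuous_evenMarkTrunc k l L) r κ t hem).aemeasurable]

/-- **S4 at RUNG 0 from two STATIC inputs** (conclusion: the registered signature specialised to
constant profiles `(a, u, θ)`, law `G_N` = canonical Gibbs, flow invariant).  Inputs (hypothesis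
types; no flow inside the variance, time enters only through `χ(t, ·)`):
* `hA` — STATIC TUBE VARIANCE `Var_{G_N}(A_t^{klL}) ≤ ς` for `N ≥ N₀`: a low-density CANONICAL cluster
  bound for the bounded tube U-statistic `((N+1)κ)⁻¹ Σ_{i≠j} 𝟙_{tube}(zᵢ,zⱼ) m(zᵢ,zⱼ; ρ_r)` whose
  kernel lives at CONTACT scale `ε = σ(N+1)^{-1/3}`: (2-point) `E 𝟙_{tube}(z₁,z₂) = O(κ/(N+1))`,
  (3-point) `E 𝟙_{tube}(z₁,z₂)𝟙_{tube}(z₁,z₃) = O((κ/(N+1))²)`, (4-point, the heart)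
  `Cov(m₁₂, m₃₄) = o((κ/(N+1))²)` — relative decorrelation of two DISJOINT near-contact pairs
  (integrated truncated 4-point canonical correlation at contact scale, plus the `O(1/N)` canonical
  constraint).  The tree's cluster machinery (`HardSphereCanonicalTorus`, `HardSphereEulerLLN`)
  decorates points with ONE-body macroscopic test functions only (Pulvirenti–Tsagkarogiannis §3–4);
* `hE` — STATIC ENSKOG-RATE VARIANCE: measurability of `e_t` and `Var_{G_N}(e_t) ≤ ς` for `N ≥ N₀`:
  the macroscopic-scale LLN under `G_N` for `ρ_r(z,x) → 1` and for the pair V-statistic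
  `B_r(z,x) = ∫∫ b_r b_r Θ dμ_z dμ_z` (condition on positions: velocities are i.i.d. Maxwellian,
  disjoint-pair covariances vanish), with `g·Y` continuous on the band (`hsEosLowDensity_proof`).
Proof: Gibbs invariance removes the flow from both halves of the split, then the assembly of
`fixedTimeVariance_of_evolved`. [folklore] -/
theorem fixedTimeVariance_rung0_of_static
    (hA : ∃ η₀ : ℝ, 0 < η₀ ∧ ∀ (a θ : ℝ) (u : V3), 0 < a → 0 < θ → ∃ σ₀ : ℝ, 0 < σ₀ ∧
      ∀ σ : ℝ, 0 < σ → σ < σ₀ →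
      ∀ Φ : (N : ℕ) → HardSphereFlow (Torus.geometry (Fin 3)) (hsDiameter σ N) (N + 1),
      ∀ τ : ℝ, 0 < τ → ∀ χ : ℝ × UnitAddTorus (Fin 3) → ℝ, Continuous χ → ∀ g : ℝ → ℝ, Continuous g →
      (∀ a', η₀ ≤ a' → g a' = 0) →
      ∀ ς : ℝ, 0 < ς → ∃ r₀ : ℝ, 0 < r₀ ∧ ∀ r : ℝ, 0 < r → r < r₀ →
      ∀ L κ : ℝ, 1 ≤ L → 0 < κ → κ ≤ 1 → ∃ N₀ : ℕ, ∀ N : ℕ, N₀ ≤ N → ∀ k l : Fin 3,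
      ∀ t ∈ Set.Icc (0 : ℝ) τ,
        ProbabilityTheory.variance (fun z => tubeStat σ N χ g (evenMarkTrunc k l L) r r 1 κ t z)
          (localGibbsLaw σ (fun _ => a) (fun _ => u) (fun _ => θ) N (Φ N)) ≤ ς)
    (hE : ∃ η₀ : ℝ, 0 < η₀ ∧ ∀ (a θ : ℝ) (u : V3), 0 < a → 0 < θ → ∃ σ₀ : ℝ, 0 < σ₀ ∧
      ∀ σ : ℝ, 0 < σ → σ < σ₀ →
      ∀ Φ : (N : ℕ) → HardSphereFlow (Torus.geometry (Fin 3)) (hsDiameter σ N) (N + 1),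
      ∀ τ : ℝ, 0 < τ → ∀ χ : ℝ × UnitAddTorus (Fin 3) → ℝ, Continuous χ → ∀ g : ℝ → ℝ, Continuous g →
      (∀ a', η₀ ≤ a' → g a' = 0) →
      ∀ ς : ℝ, 0 < ς → ∃ r₀ : ℝ, 0 < r₀ ∧ ∀ r : ℝ, 0 < r → r < r₀ →
      ∀ L κ : ℝ, 1 ≤ L → 0 < κ → κ ≤ 1 → ∃ N₀ : ℕ, ∀ N : ℕ, N₀ ≤ N → ∀ k l : Fin 3,
      ∀ t ∈ Set.Icc (0 : ℝ) τ,
        (Measurable fun z => enskogRate σ N χ g (evenMarkTrunc k l L) r t z) ∧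
        ProbabilityTheory.variance (fun z => enskogRate σ N χ g (evenMarkTrunc k l L) r t z)
          (localGibbsLaw σ (fun _ => a) (fun _ => u) (fun _ => θ) N (Φ N)) ≤ ς) :
    ∃ η₀ : ℝ, 0 < η₀ ∧ ∀ (a θ : ℝ) (u : V3), 0 < a → 0 < θ → ∃ σ₀ : ℝ, 0 < σ₀ ∧ ∀ σ : ℝ, 0 < σ → σ < σ₀ →
      ∀ Φ : (N : ℕ) → HardSphereFlow (Torus.geometry (Fin 3)) (hsDiameter σ N) (N + 1),
      ∀ τ : ℝ, 0 < τ → ∀ χ : ℝ × UnitAddTorus (Fin 3) → ℝ, Continuous χ → ∀ g : ℝ → ℝ, Continuous g →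
      (∀ a', η₀ ≤ a' → g a' = 0) →
      ∀ ς : ℝ, 0 < ς → ∃ r₀ : ℝ, 0 < r₀ ∧ ∀ r : ℝ, 0 < r → r < r₀ →
      ∀ L κ : ℝ, 1 ≤ L → 0 < κ → κ ≤ 1 → ∃ N₀ : ℕ, ∀ N : ℕ, N₀ ≤ N → ∀ k l : Fin 3, ∀ t ∈ Set.Icc (0 : ℝ) τ,
        ProbabilityTheory.variance
          (fun z => evenTubeStat σ N χ g (evenMarkTrunc k l L) r κ t ((Φ N).flow t z))
          (localGibbsLaw σ (fun _ => a) (fun _ => u) (fun _ => θ) N (Φ N)) ≤ ς := by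
  obtain ⟨η₁, hη₁, HA⟩ := hA
  obtain ⟨η₂, hη₂, HE⟩ := hE
  refine ⟨min η₁ η₂, lt_min hη₁ hη₂, ?_⟩
  intro a θ u ha hθ
  obtain ⟨σ₁, hσ₁, HA⟩ := HA a θ u ha hθ
  obtain ⟨σ₂, hσ₂, HE⟩ := HE a θ u ha hθ
  refine ⟨min (min σ₁ σ₂) (1 / 2), lt_min (lt_min hσ₁ hσ₂) (by norm_num), ?_⟩
  intro σ hσ hσlt Φ τ hτ χ hχ g hg hg0 ς hς
  have hσ12 : σ < min σ₁ σ₂ := lt_of_lt_of_le hσlt (min_le_left _ _)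
  have hσhalf : σ ≤ 1 / 2 := (lt_of_lt_of_le hσlt (min_le_right _ _)).le
  have hg1 : ∀ a', η₁ ≤ a' → g a' = 0 := fun a' h => hg0 a' ((min_le_left _ _).trans h)
  have hg2 : ∀ a', η₂ ≤ a' → g a' = 0 := fun a' h => hg0 a' ((min_le_right _ _).trans h)
  obtain ⟨r₁, hr₁, HA⟩ := HA σ hσ (lt_of_lt_of_le hσ12 (min_le_left _ _)) Φ τ hτ χ hχ g hg hg1
    (ς / 4) (by positivity)
  obtain ⟨r₂, hr₂, HE⟩ := HE σ hσ (lt_of_lt_of_le hσ12 (min_le_right _ _)) Φ τ hτ χ hχ g hg hg2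
    (ς / 4) (by positivity)
  refine ⟨min r₁ r₂, lt_min hr₁ hr₂, ?_⟩
  intro r hr hrlt L κ hL hκ hκ1
  obtain ⟨N₁, HA⟩ := HA r hr (lt_of_lt_of_le hrlt (min_le_left _ _)) L κ hL hκ hκ1
  obtain ⟨N₂, HE⟩ := HE r hr (lt_of_lt_of_le hrlt (min_le_right _ _)) L κ hL hκ hκ1
  refine ⟨max N₁ N₂, fun N hN k l t ht => ?_⟩
  have hA' := HA N ((le_max_left _ _).trans hN) k l t ht
  obtain ⟨hem, hE'⟩ := HE N ((le_max_right _ _).trans hN) k l t ht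
  haveI : IsProbabilityMeasure (localGibbsLaw σ (fun _ => a) (fun _ => u) (fun _ => θ) N (Φ N)) :=
    isProbabilityMeasure_localGibbsLaw continuous_const continuous_const continuous_const
      (fun _ => ha) (fun _ => hθ) hσhalf N (Φ N)
  obtain ⟨B, hB⟩ := exists_bound_tubeStat_even σ N hχ hg k l (zero_le_one.trans hL) hr hκ.le τ
  have hsplit := variance_evenTubeStat_flow_le σ N hχ hg (continuous_evenMarkTrunc k l L) r κ t
    (Φ N) (localGibbsLaw σ (fun _ => a) (fun _ => u) (fun _ => θ) N (Φ N)) (fun z => hB t ht z) hem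
  rw [variance_comp_flow_localGibbsLaw_const σ a θ u N (Φ N) t
      (measurable_tubeStat_at σ N hχ hg (continuous_evenMarkTrunc k l L) r r 1 κ t).aemeasurable,
    variance_comp_flow_localGibbsLaw_const σ a θ u N (Φ N) t hem.aemeasurable] at hsplit
  exact split_le_of_le hsplit hA' hE' (variance_nonneg _ _) (cube_sq_le_one hσ.le (by linarith))

/-- **Registered helper stub `stub_fixedTimeVarianceOfEvolved`** (crux stmt-AtomisticToContinuum-13079,
line `even-rung-mean-variance`): the two fixed-time concentration inputs — tube half
`Var_{LG}(A_t^{klL} ∘ Φ_t) ≤ ς` and Enskog half `e_t` measurable with `Var_{LG}(e_t ∘ Φ_t) ≤ ς`, in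
the crux's quantifier frame — imply the registered S4 `stub_fixedTimeVariance` verbatim (arrow form
of `fixedTimeVariance_of_evolved`). [folklore] -/
theorem stub_fixedTimeVarianceOfEvolved :
    (∃ η₀ : ℝ, 0 < η₀ ∧ ∀ (a₀ θ₀ : T3 → ℝ) (u₀ : T3 → V3), Continuous a₀ → Continuous θ₀ →
      Continuous u₀ → (∀ x, 0 < a₀ x) → (∀ x, 0 < θ₀ x) → ∃ σ₀ : ℝ, 0 < σ₀ ∧ ∀ σ : ℝ, 0 < σ → σ < σ₀ →
      ∀ Φ : (N : ℕ) → HardSphereFlow (Torus.geometry (Fin 3)) (hsDiameter σ N) (N + 1),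
      ∀ τ : ℝ, 0 < τ → ∀ χ : ℝ × UnitAddTorus (Fin 3) → ℝ, Continuous χ → ∀ g : ℝ → ℝ, Continuous g →
      (∀ a, η₀ ≤ a → g a = 0) →
      ∀ ς : ℝ, 0 < ς → ∃ r₀ : ℝ, 0 < r₀ ∧ ∀ r : ℝ, 0 < r → r < r₀ →
      ∀ L κ : ℝ, 1 ≤ L → 0 < κ → κ ≤ 1 → ∃ N₀ : ℕ, ∀ N : ℕ, N₀ ≤ N → ∀ k l : Fin 3,
      ∀ t ∈ Set.Icc (0 : ℝ) τ,
        ProbabilityTheory.variance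
          (fun z => tubeStat σ N χ g (evenMarkTrunc k l L) r r 1 κ t ((Φ N).flow t z))
          (localGibbsLaw σ a₀ u₀ θ₀ N (Φ N)) ≤ ς) →
    (∃ η₀ : ℝ, 0 < η₀ ∧ ∀ (a₀ θ₀ : T3 → ℝ) (u₀ : T3 → V3), Continuous a₀ → Continuous θ₀ →
      Continuous u₀ → (∀ x, 0 < a₀ x) → (∀ x, 0 < θ₀ x) → ∃ σ₀ : ℝ, 0 < σ₀ ∧ ∀ σ : ℝ, 0 < σ → σ < σ₀ →
      ∀ Φ : (N : ℕ) → HardSphereFlow (Torus.geometry (Fin 3)) (hsDiameter σ N) (N + 1),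
      ∀ τ : ℝ, 0 < τ → ∀ χ : ℝ × UnitAddTorus (Fin 3) → ℝ, Continuous χ → ∀ g : ℝ → ℝ, Continuous g →
      (∀ a, η₀ ≤ a → g a = 0) →
      ∀ ς : ℝ, 0 < ς → ∃ r₀ : ℝ, 0 < r₀ ∧ ∀ r : ℝ, 0 < r → r < r₀ →
      ∀ L κ : ℝ, 1 ≤ L → 0 < κ → κ ≤ 1 → ∃ N₀ : ℕ, ∀ N : ℕ, N₀ ≤ N → ∀ k l : Fin 3,
      ∀ t ∈ Set.Icc (0 : ℝ) τ,
        (Measurable fun z => enskogRate σ N χ g (evenMarkTrunc k l L) r t z) ∧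
        ProbabilityTheory.variance
          (fun z => enskogRate σ N χ g (evenMarkTrunc k l L) r t ((Φ N).flow t z))
          (localGibbsLaw σ a₀ u₀ θ₀ N (Φ N)) ≤ ς) →
    ∃ η₀ : ℝ, 0 < η₀ ∧ ∀ (a₀ θ₀ : T3 → ℝ) (u₀ : T3 → V3), Continuous a₀ → Continuous θ₀ → Continuous u₀ →
      (∀ x, 0 < a₀ x) → (∀ x, 0 < θ₀ x) → ∃ σ₀ : ℝ, 0 < σ₀ ∧ ∀ σ : ℝ, 0 < σ → σ < σ₀ →
      ∀ Φ : (N : ℕ) → HardSphereFlow (Torus.geometry (Fin 3)) (hsDiameter σ N) (N + 1),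
      ∀ τ : ℝ, 0 < τ → ∀ χ : ℝ × UnitAddTorus (Fin 3) → ℝ, Continuous χ → ∀ g : ℝ → ℝ, Continuous g →
      (∀ a, η₀ ≤ a → g a = 0) →
      ∀ ς : ℝ, 0 < ς → ∃ r₀ : ℝ, 0 < r₀ ∧ ∀ r : ℝ, 0 < r → r < r₀ →
      ∀ L κ : ℝ, 1 ≤ L → 0 < κ → κ ≤ 1 → ∃ N₀ : ℕ, ∀ N : ℕ, N₀ ≤ N → ∀ k l : Fin 3, ∀ t ∈ Set.Icc (0 : ℝ) τ,
        ProbabilityTheory.variance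
          (fun z => evenTubeStat σ N χ g (evenMarkTrunc k l L) r κ t ((Φ N).flow t z))
          (localGibbsLaw σ a₀ u₀ θ₀ N (Φ N)) ≤ ς :=
  fun hA hE => fixedTimeVariance_of_evolved hA hE

end Summit.AtomisticToContinuum.HydrodynamicLimit.Theorems.EvenStressEnskog

end
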